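import Literature.NumberTheory.EllipticCurves.QuadraticTwistLocalDataAtTwoHoldsProofs
import Literature.NumberTheory.EllipticCurves.SupersingularAtTwoDiscriminantModEight
import Literature.NumberTheory.EllipticCurves.TamagawaRingEquivProofs
import Literature.NumberTheory.EllipticCurves.TamagawaVariableChangeProofs
import Literature.NumberTheory.EllipticCurves.QuadraticTwistPadicReduction
import Literature.NumberTheory.EllipticCurves.QuadraticTwistJInvariantProofs
import Literature.NumberTheory.EllipticCurves.Rank1Residual.Predicates
import HarnessLib

/-!
# Route `ByReductionTypeAtTwo` (rung K4), crux `SupersingularRankZeroAtTwo` (item stmt-BirchSwinnertonDyer-19097), line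
# `odd_blind_package` slot 5 (CDC_H `OddBlindPackage.FlatBlindControlCardHondaAtTwo`): the CURVE CONSTANT at `2` —
# **`c₂(W₂) = 1`: the quadratic twist by `2` of a curve with good SUPERSINGULAR reduction at `2` has Kodaira type II at `2`**
# (cell `bsd-2adic`, LEAD ss-1 GEN 21; memo `HOME/ss/gen21/HAND-TARGETS-CDC-2.md` §1 step 8, constant audit)

HONEST FRAMING: THEOREMS ONLY (no definition, no named fact, no `sorry`, no instance); a helper
(`--supports stmt-BirchSwinnertonDyer-19097`): it does NOT prove CDC_H or the crux; nothing booked; BSD is proved for no curve by any of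
this. bears_on: K4 (19097).

## What is proved and why it matters

CDC_H's right-hand side carries `v₂ Tam(W₂)` and `2·(padicLogOrd W₂ 2 ι P − v₂[W₂(ℚ):ℤP])`; the LEAD's constant audit (memo §1) shows
`padicLogOrd − v₂[…] = ι(P₁) − v₂ c₂(W₂)` and hence **CDC ⟺ t = −v₂ c₂(W₂)**, so CDC_H needs `c₂(W₂)` ODD as a THEOREM. It is `1`:
for `W/ℚ` globally minimal with `GoodSS W 2` (good reduction at `2`, `2 ∣ a₂`), the minimal equation has `2 ∣ a₁`
(`two_dvd_a₁_integralModelInt_of_two_dvd_frobeniusTrace_two`: supersingular in characteristic `2` iff `ā₁ = 0`), so over `ℤ₂` it is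
`ℤ₂`-isomorphic to a normal form `V = ⟨0, a₂, a₃, a₄, a₆⟩` with unit discriminant (`TwistGoodTwo.exists_smul_a₁_eq_zero`), and the twist by
`d = 2 = 2·1` is `ℚ₂`-isomorphic to the model `⟨0, 2a₂, 0, 4a₄, 2(a₃² + 4a₆)⟩` (`TwistGoodTwo.quadraticTwist_eq_modelTwo'`) on which Tate's
algorithm exits at Step 3 with type **II**, `c = 1` (`TwistGoodTwo.kodairaSymbolOfMinimal_twistGoodSupersingular_two`, the supersingular
sub-row «`v(d) = 1`, `v(a₁) ≥ 1`: `II`, `(δ,δ^d) = (0,6)`, `(c,c^d) = (1,1)`» of Barrios–Roy–Sahajpal–Tallana–Tobin–Wiersema 2025 Thm. 5.1;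
the ORDINARY sub-row is `I₈*` with `c ∈ {2, 4}` — so CDC's shape must not be copied to an ordinary crux). Read on any model
(`localTamagawaNumber_variableChange_holds`) and at the place `v ∋ 2` of `ℚ` (`localTamagawaNumber_padic_eq_holds`):

* `kodairaSymbol_twist_two_of_goodSS` — `(W₂ ⊗ ℚ₂).kodairaSymbol ℤ₂ = II` for every model `W₂` of the twist of `W` by `2`;
* `localTamagawaNumber_padic_twist_two_of_goodSS` — `(W₂ ⊗ ℚ₂).localTamagawaNumber ℤ₂ = 1`;
* ★ `localTamagawaNumber_twist_two_of_goodSS` — `(W₂ ⊗ ℚ_v).localTamagawaNumber 𝓞_v = 1` at the place `v ∋ 2` (the factor of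
  `W₂.tamagawaProduct` at `2`), the form the CDC_H glue consumes.

References: [BarriosEtAl2025] Thm. 5.1, §5 table `v(d) = 1`, row `I₀`, sub-row `v(a₁) ≥ 1` (arXiv:2501.03209 p. 16), §5.2 Case 1;
[SilvermanATAEC1994] IV.9.4 Steps 1–3 and Table 4.1; [SilvermanAEC2009] V.4, Ex. 5.7 (supersingular in characteristic 2 iff `a₁ = 0`),
VII.1 Prop. 1.3(b), VII.6 Ex. 7.6.
-/

set_option autoImplicit false
set_option linter.dupNamespace false

noncomputable section

open scoped Classical NumberField

namespace Summit.BirchSwinnertonDyer.BirchSwinnertonDyer.Theorems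

namespace OddBlindLocal

open NumberField IsDedekindDomain IsLocalRing WeierstrassCurve Literature.NumberTheory.EllipticCurves
  Literature.NumberTheory.EllipticCurves.TwistGoodTwo Literature.NumberTheory.EllipticCurves.Rank1Residual
  Literature.NumberTheory.DiophantineGeometry Literature.NumberTheory.DiophantineGeometry.TateAlgorithm
open IsDiscreteValuationRing hiding maximalIdeal

/-- Transport of a model identity along `C₁ • E = V ⊗ ℚ₂`: a change of variables taking `(V ⊗ ℚ₂)^{(d)}` to `M ⊗ ℚ₂` yields one taking
`E^{(d)}` to `M ⊗ ℚ₂` (`quadraticTwist_smul`: `(C₁ • E)^{(d)} = (u; d r, 0, 0) • E^{(d)}`).  Adapted from the private lemma of the same name in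
`QuadraticTwistLocalDataAtTwoHoldsProofs`. [cite: SilvermanAEC2009, X.5 Cor. 5.4.1] -/
theorem exists_smul_quadraticTwist_eq_baseChange_of_smul_eq (E : WeierstrassCurve ℚ_[2])
    (V M : WeierstrassCurve ℤ_[2]) (C₁ : WeierstrassCurve.VariableChange ℚ_[2])
    (hVE : C₁ • E = V.baseChange ℚ_[2]) (d : ℚ_[2])
    (hM : ∃ C : WeierstrassCurve.VariableChange ℚ_[2],
      C • ((V.baseChange ℚ_[2]).quadraticTwist d) = M.baseChange ℚ_[2]) :
    ∃ C : WeierstrassCurve.VariableChange ℚ_[2], C • (E.quadraticTwist d) = M.baseChange ℚ_[2] := by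
  obtain ⟨C, hC⟩ := hM
  refine ⟨C * ⟨C₁.u, d * C₁.r, 0, 0⟩, ?_⟩
  rw [mul_smul, ← WeierstrassCurve.quadraticTwist_smul, hVE, hC]

/-- **A globally minimal `W/ℚ` with `GoodSS W 2` has a `ℤ₂`-model `V` with `a₁ = 0` and unit discriminant**, `ℚ₂`-isomorphic to `W ⊗ ℚ₂`:
the integral minimal equation has unit discriminant at `2` (good reduction) and `2 ∣ a₁` (`2 ∣ a₂(W)` ⟺ supersingular ⟺ `ā₁ = 0`,
`two_dvd_a₁_integralModelInt_of_two_dvd_frobeniusTrace_two`), and `a₁ ∈ 2ℤ₂` is killed by the translation `s = −a₁/2`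
(`TwistGoodTwo.exists_smul_a₁_eq_zero`). [cite: SilvermanAEC2009, V.4 and Ex. 5.7; III.1 Table 3.1] -/
theorem exists_model_a₁_eq_zero_of_goodSS (W : WeierstrassCurve ℚ) [W.IsElliptic] [W.IsGloballyMinimal] (hss : GoodSS W 2)
    {ε : ℤ_[2]} (hε : (2 : ℤ_[2]) = uniformizer ℤ_[2] * ε) (hεu : IsUnit ε) :
    ∃ (V : WeierstrassCurve ℤ_[2]) (C₁ : WeierstrassCurve.VariableChange ℚ_[2]),
      C₁ • W.baseChange ℚ_[2] = V.baseChange ℚ_[2] ∧ IsUnit V.Δ ∧ V.a₁ = 0 := by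
  obtain ⟨hgood, heven⟩ := hss
  -- the integral minimal equation, pushed to `ℤ₂`
  set V₀ : WeierstrassCurve ℤ_[2] := (integralModelInt W).map (Int.castRingHom ℤ_[2]) with hV₀
  have hV₀E : V₀.baseChange ℚ_[2] = W.baseChange ℚ_[2] := by
    conv_rhs => rw [← map_integralModelInt W]
    rw [hV₀, WeierstrassCurve.baseChange, WeierstrassCurve.baseChange, WeierstrassCurve.map_map, WeierstrassCurve.map_map]
    congr 1
  -- unit discriminant: `2 ∤ Δ_min`
  have hΔ₀ : IsUnit V₀.Δ := by
    have hΔ : V₀.Δ = ((minimalDiscriminantInt W : ℤ) : ℤ_[2]) := by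
      rw [hV₀, WeierstrassCurve.map_Δ, eq_intCast]; rfl
    have hndvd : ¬ ((2 : ℕ) : ℤ) ∣ minimalDiscriminantInt W :=
      not_dvd_minimalDiscriminantInt_of_hasGoodReductionAtPrime' W 2 hgood
    rw [hΔ, PadicInt.isUnit_iff]
    by_contra hne
    have hlt : ‖((minimalDiscriminantInt W : ℤ) : ℤ_[2])‖ < 1 := lt_of_le_of_ne (PadicInt.norm_le_one _) hne
    exact hndvd (by exact_mod_cast (PadicInt.norm_int_lt_one_iff_dvd _).mp hlt)
  -- `ϖ ∣ a₁`
  have ha₁ : uniformizer ℤ_[2] ∣ V₀.a₁ := by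
    have h2 : (2 : ℤ) ∣ (integralModelInt W).a₁ := two_dvd_a₁_integralModelInt_of_two_dvd_frobeniusTrace_two W hgood heven
    obtain ⟨m, hm⟩ := h2
    refine ⟨ε * (m : ℤ_[2]), ?_⟩
    rw [hV₀, WeierstrassCurve.map_a₁, eq_intCast, hm, Int.cast_mul, Int.cast_ofNat, hε, mul_assoc]
  obtain ⟨D, hDu, hD1⟩ := exists_smul_a₁_eq_zero hε hεu V₀ ha₁
  refine ⟨D • V₀, D.map (algebraMap ℤ_[2] ℚ_[2]), ?_, ?_, hD1⟩
  · rw [← hV₀E, WeierstrassCurve.baseChange, WeierstrassCurve.baseChange, WeierstrassCurve.map_variableChange]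
  · rw [WeierstrassCurve.variableChange_Δ, hDu, inv_one, Units.val_one, one_pow, one_mul]
    exact hΔ₀

/-- **Kodaira type II and `c = 1` at `2` for the twist by `2` of a good SUPERSINGULAR curve, on `W ⊗ ℚ₂`.**  For `W/ℚ` globally minimal with
`GoodSS W 2`: `((W ⊗ ℚ₂)^{(2)}).kodairaSymbol ℤ₂ = II` and `((W ⊗ ℚ₂)^{(2)}).localTamagawaNumber ℤ₂ = 1` — Tate's algorithm on the model
`⟨0, 2a₂, 0, 4a₄, 2(a₃² + 4a₆)⟩` of the twist (Step 3 exit, `v(Δ) = 6`), Barrios et al. 2025 Thm. 5.1, table `v(d) = 1`, row `I₀`, sub-row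
`v(a₁) ≥ 1`. [cite: BarriosEtAl2025, Thm. 5.1, §5 table v(d) = 1, row I₀, sub-row v(a₁) ≥ 1 (arXiv:2501.03209 p. 16); §5.2 Case 1]
[cite: SilvermanATAEC1994, IV.9.4 Steps 1–3 (PDF pp. 344–345) and Table 4.1] -/
theorem kodairaSymbol_and_localTamagawaNumber_quadraticTwist_two_padic_of_goodSS (W : WeierstrassCurve ℚ) [W.IsElliptic]
    [W.IsGloballyMinimal] (hss : GoodSS W 2) :
    ((W.baseChange ℚ_[2]).quadraticTwist (2 : ℚ_[2])).kodairaSymbol ℤ_[2] = .II ∧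
      ((W.baseChange ℚ_[2]).quadraticTwist (2 : ℚ_[2])).localTamagawaNumber ℤ_[2] = 1 := by
  haveI := perfectField_residueField_padicInt
  obtain ⟨ε, hεu, hε⟩ := exists_isUnit_two_eq_uniformizer_mul_padicInt
  obtain ⟨V, C₁, hVE, hVΔ, h1⟩ := exists_model_a₁_eq_zero_of_goodSS W hss hε hεu
  haveI : (W.baseChange ℚ_[2]).IsElliptic := by rw [WeierstrassCurve.baseChange]; infer_instance
  haveI := WeierstrassCurve.isElliptic_quadraticTwist (W.baseChange ℚ_[2]) (two_ne_zero (α := ℚ_[2]))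
  have hd₁ : (2 * 0 + 1 : ℤ) = 2 * 0 + 1 := rfl
  obtain ⟨hK, -, -⟩ := kodairaSymbolOfMinimal_twistGoodSupersingular_two hε hεu V h1 hVΔ hd₁
  have hdd : (2 : ℚ_[2]) = ((2 * (2 * 0 + 1) : ℤ) : ℚ_[2]) := by push_cast; ring
  obtain ⟨C, hC⟩ := exists_smul_quadraticTwist_eq_baseChange_of_smul_eq (W.baseChange ℚ_[2]) V _ C₁ hVE (2 : ℚ_[2])
    ⟨1, by rw [one_smul, hdd]; exact quadraticTwist_eq_modelTwo' hε hεu V h1 (2 * 0 + 1)⟩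
  obtain ⟨hk', hc, -⟩ := kodairaSymbol_and_localTamagawaNumber_of_model_padic _ _ C hC (by rw [hK]; decide)
  exact ⟨hk'.trans hK, hc (Or.inl hK)⟩

/-- **`(W₂ ⊗ ℚ₂).kodairaSymbol ℤ₂ = II` for every model `W₂` of the twist by `2`** (Kodaira symbols are isomorphism invariants,
`kodairaSymbol_smul`). [cite: BarriosEtAl2025, Thm. 5.1, §5 table v(d) = 1, row I₀, sub-row v(a₁) ≥ 1] [cite: SilvermanATAEC1994, IV.9.4 Table 4.1] -/
theorem kodairaSymbol_twist_two_of_goodSS (W : WeierstrassCurve ℚ) [W.IsElliptic] [W.IsGloballyMinimal] (hss : GoodSS W 2)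
    (W₂ : WeierstrassCurve ℚ) (htw : ∃ C : WeierstrassCurve.VariableChange ℚ, C • W.quadraticTwist 2 = W₂) :
    (W₂.baseChange ℚ_[2]).kodairaSymbol ℤ_[2] = .II := by
  obtain ⟨C, rfl⟩ := htw
  haveI : (W.baseChange ℚ_[2]).IsElliptic := by rw [WeierstrassCurve.baseChange]; infer_instance
  haveI := WeierstrassCurve.isElliptic_quadraticTwist (W.baseChange ℚ_[2]) (two_ne_zero (α := ℚ_[2]))
  haveI := perfectField_residueField_padicInt
  have h := (kodairaSymbol_and_localTamagawaNumber_quadraticTwist_two_padic_of_goodSS W hss).1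
  rw [WeierstrassCurve.baseChange, ← WeierstrassCurve.map_variableChange, WeierstrassCurve.map_quadraticTwist, map_ofNat,
    ← WeierstrassCurve.baseChange,
    WeierstrassCurve.kodairaSymbol_smul_holds (R := ℤ_[2]) ((W.baseChange ℚ_[2]).quadraticTwist (2 : ℚ_[2]))
      (C.map (algebraMap ℚ ℚ_[2]))]
  exact h

/-- **`c₂ = 1` on `W₂ ⊗ ℚ₂` for every model `W₂` of the twist by `2`** of a globally minimal `W` with `GoodSS W 2` (the Tamagawa number is an
isomorphism invariant, `localTamagawaNumber_variableChange_holds`; base change commutes with the twist, `map_quadraticTwist`).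
[cite: BarriosEtAl2025, Thm. 5.1, §5 table v(d) = 1, row I₀, sub-row v(a₁) ≥ 1] [cite: SilvermanAEC2009, VII.1 Prop. 1.3(b), VII.6 Ex. 7.6] -/
theorem localTamagawaNumber_padic_twist_two_of_goodSS (W : WeierstrassCurve ℚ) [W.IsElliptic] [W.IsGloballyMinimal]
    (hss : GoodSS W 2) (W₂ : WeierstrassCurve ℚ) [W₂.IsElliptic]
    (htw : ∃ C : WeierstrassCurve.VariableChange ℚ, C • W.quadraticTwist 2 = W₂) :
    (W₂.baseChange ℚ_[2]).localTamagawaNumber ℤ_[2] = 1 := by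
  obtain ⟨C, hC⟩ := htw
  haveI : (W.baseChange ℚ_[2]).IsElliptic := by rw [WeierstrassCurve.baseChange]; infer_instance
  haveI := WeierstrassCurve.isElliptic_quadraticTwist (W.baseChange ℚ_[2]) (two_ne_zero (α := ℚ_[2]))
  have h := (kodairaSymbol_and_localTamagawaNumber_quadraticTwist_two_padic_of_goodSS W hss).2
  have hW₂ : W₂.baseChange ℚ_[2] = C.map (algebraMap ℚ ℚ_[2]) • (W.baseChange ℚ_[2]).quadraticTwist (2 : ℚ_[2]) := by
    rw [← hC, WeierstrassCurve.baseChange, ← WeierstrassCurve.map_variableChange, WeierstrassCurve.map_quadraticTwist, map_ofNat,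
      ← WeierstrassCurve.baseChange]
  rw [hW₂, WeierstrassCurve.localTamagawaNumber_variableChange_holds]
  exact h

/-- ★ **`c₂(W₂) = 1` AT THE PLACE `v ∋ 2` OF `ℚ`** (the factor of `W₂.tamagawaProduct` at `2`): for `W/ℚ` globally minimal with `GoodSS W 2` and
any elliptic model `W₂` of its quadratic twist by `2`, `(W₂ ⊗ ℚ_v).localTamagawaNumber 𝓞_v = 1` — the Kodaira type at `2` is II.  The
`ℚ_v ↔ ℚ_[2]` transport is `localTamagawaNumber_padic_eq_holds`.  CDC road: with the log normalisation this is the constant making CDC_H's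
right-hand side `v₂#Ш + Σ_{ℓ odd} v₂ c_ℓ + 2ι(P₁)`. [cite: BarriosEtAl2025, Thm. 5.1, §5 table v(d) = 1, row I₀, sub-row v(a₁) ≥ 1 (arXiv:2501.03209 p. 16)]
[cite: SilvermanATAEC1994, IV.9.4 Steps 1–3 and Table 4.1] -/
theorem localTamagawaNumber_twist_two_of_goodSS (W : WeierstrassCurve ℚ) [W.IsElliptic] [W.IsGloballyMinimal]
    (hss : GoodSS W 2) (W₂ : WeierstrassCurve ℚ) [W₂.IsElliptic]
    (htw : ∃ C : WeierstrassCurve.VariableChange ℚ, C • W.quadraticTwist 2 = W₂)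
    (v : HeightOneSpectrum (𝓞 ℚ)) (hv : (2 : 𝓞 ℚ) ∈ v.asIdeal) :
    (W₂.baseChange (v.adicCompletion ℚ)).localTamagawaNumber (v.adicCompletionIntegers ℚ) = 1 := by
  have hv2 : (Rat.HeightOneSpectrum.primesEquiv (R := 𝓞 ℚ) v : ℕ) = 2 := by
    have hmem : ((2 : ℕ) : ℤ) ∈ v.asIdeal.map (Rat.IsIntegralClosure.intEquiv (𝓞 ℚ)) := by
      have h := Ideal.mem_map_of_mem (Rat.IsIntegralClosure.intEquiv (𝓞 ℚ)) hv
      rwa [map_ofNat] at h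
    have hdvd : Rat.HeightOneSpectrum.natGenerator v ∣ 2 := (Rat.HeightOneSpectrum.natGenerator_dvd_iff v).mpr hmem
    exact (Nat.prime_dvd_prime_iff_eq (Rat.HeightOneSpectrum.prime_natGenerator v) Nat.prime_two).mp hdvd
  rw [← WeierstrassCurve.localTamagawaNumber_padic_eq_holds W₂ v 2 hv2]
  exact localTamagawaNumber_padic_twist_two_of_goodSS W hss W₂ htw

end OddBlindLocal

end Summit.BirchSwinnertonDyer.BirchSwinnertonDyer.Theorems

end
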